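import Summits.BirchSwinnertonDyer.BirchSwinnertonDyer.Theses.ResidualThetaTransportAtTwo
import Summits.BirchSwinnertonDyer.BirchSwinnertonDyer.Theses.ThetaPartnerAtTwo
import Summits.BirchSwinnertonDyer.BirchSwinnertonDyer.Theorems.ThetaPartnerAtTwoSignedControlAtTwoStubPlusHondaSystemTwo
import Summits.BirchSwinnertonDyer.BirchSwinnertonDyer.Theorems.ThetaPartnerAtTwoSignedControlAtTwoPlusKimOfPrintKummer
import Summits.BirchSwinnertonDyer.BirchSwinnertonDyer.Theorems.ThetaPartnerAtTwoSignedControlAtTwoPlusLocEngine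
import Summits.BirchSwinnertonDyer.BirchSwinnertonDyer.Theorems.ThetaPartnerAtTwoSignedControlAtTwoPlusCoinvOfHonda
import Summits.BirchSwinnertonDyer.BirchSwinnertonDyer.Theorems.ThetaPartnerAtTwoSignedControlAtTwoPlusCyclicLayersOfHonda
import Summits.BirchSwinnertonDyer.BirchSwinnertonDyer.Theorems.ThetaPartnerAtTwoSignedControlAtTwoPlusLocalInjOfCyclic
import Summits.BirchSwinnertonDyer.BirchSwinnertonDyer.Theorems.ThetaPartnerAtTwoSignedControlAtTwoLocalNonDivTwo
import Summits.BirchSwinnertonDyer.BirchSwinnertonDyer.Theorems.ThetaPartnerAtTwoSignedControlAtTwoStubControlOfEulerCharTwo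
import Literature.NumberTheory.EllipticCurves.Kobayashi2003.SignedSelmerModuleFiniteProofs
import HarnessLib

/-!
# K4P `SignedControlAtTwoOfPub` (stmt-BirchSwinnertonDyer-24144, route `ResidualThetaTransportAtTwo`, crux rank 7) PROVED —
# the five printed Greenberg/Kato facts BY NAME ⟹ K4 `SignedControlAtTwo` (stmt-BirchSwinnertonDyer-20309) verbatim:
# the composition of line `eulerchar` v6 (lead `prover-bsd-wall-tp2-p3` g2, skeleton `Cruxes/SignedControlAtTwo/Lines/eulerchar.lean`
# 8d2b4be25f391f24) with its ONE research stub HONDA⁺@2 replaced by the tree theorem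
# `Cruxes.SignedControlAtTwo.EulerChar.stub_plusHondaSystemTwo` (p591589) and its PUB stub replaced by the five antecedents of K4P

Seat `prover-bsd-wall-tp2-p3-w2` (width seat 2/3, g2), cell `bsd-wall`. This file is the v6 skeleton's body VERBATIM (theorems CYC⁺@2,
INJ⁺@2, LOC⁺@2, EC2 — credit: lead tp2-p3 g0/g2 and width seats w2/w3 as recorded in the skeleton), moved to the `Theorems` namespace,
with `stub_pubGreenbergTwo` turned into the hypotheses `hC h412 hcork hP108 hWL` and the final composition retargeted at the RTT twin
decl `Theses.ResidualThetaTransportAtTwo.SignedControlAtTwoOfPub` (= `PUB⁵ → SignedControlAtTwo`, planner bsd-wall-p2 g14, T10v2 PHASE R).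

WHAT IS PROVED: `SignedControlAtTwoOfPub_proof : …Theses.ResidualThetaTransportAtTwo.SignedControlAtTwoOfPub` — UNCONDITIONAL as a Lean
theorem (its statement carries the five printed facts as antecedents); and `signedControlAtTwo_of_pub : PUB⁵ → …Theses.ThetaPartnerAtTwo.
SignedControlAtTwo` (K4 of TP2 modulo the same five named facts — the `proof.conditional` form of 20309).
HONEST FRAMING: the five antecedents are PRINTED theorems of Greenberg LNM 1716 §§3–5 / Cassels / Kato Thm. 12.4 typed as Literature
`def … : Prop` named facts WITHOUT `_holds`; nothing here proves them. BSD is not proved by any of this.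

References: [BDKim2013] B. D. Kim, Compos. Math. 149 (2013), Cor. 3.15; [Kobayashi2003] S. Kobayashi, Invent. Math. 152 (2003), Thm. 1.2,
§8.4, Thm. 9.3; [GreenbergLNM1716] R. Greenberg, LNM 1716 (1999), §4 (Lemma 4.7, Props. 4.12–4.13, pp. 108, 119–122), §5 p. 140;
[Kato2004Asterisque] K. Kato, Astérisque 295 (2004), Thm. 12.4; [Sprung2012] Thm. 2.2; [KuriharaOtsuki2006] p. 557.
-/

set_option autoImplicit false
set_option linter.dupNamespace false

noncomputable section

open scoped NumberField

open WeierstrassCurve NumberField IsDedekindDomain Literature.NumberTheory.EllipticCurves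
  Literature.NumberTheory.EllipticCurves.Rank1Residual Literature.NumberTheory.GaloisRepresentations
  Literature.NumberTheory.EllipticCurves.Kobayashi2003 Literature.NumberTheory.EllipticCurves.IwasawaDual
  Literature.NumberTheory.EllipticCurves.Sprung2012 Literature.NumberTheory.EllipticCurves.GreenbergVatsal2000

namespace Summit.BirchSwinnertonDyer.BirchSwinnertonDyer.Theorems.SignedControlAtTwoOfPubProof

open Summit.BirchSwinnertonDyer.BirchSwinnertonDyer.Cruxes.SignedControlAtTwo.EulerChar

/-- (CYC⁺@2 = v5's registered `stub_plusCyclicLayersTwo`) — a THEOREM of HONDA⁺@2 (seat w3's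
`Theorems.SignedEC.stub_plusCyclicLayersTwo_of_honda`, Kobayashi Prop. 8.12 i) on the `ℤ₂`-tower in the kernel).
[cite: Kobayashi2003, Prop. 8.12 i) (pp. 17–18)] -/
theorem plusCyclicLayersTwo :
    ∀ (W : WeierstrassCurve ℚ) [W.IsElliptic] [W.IsGloballyMinimal],
      ¬ W.HasCM → W.analyticRank = 0 → GoodSS W 2 → W.frobeniusTrace 2 = 0 →
      ∀ (κ : ZpExtension ℚ 2), κ.IsCyclotomic →
      ∀ (v : HeightOneSpectrum (𝓞 ℚ)), (2 : 𝓞 ℚ) ∈ v.asIdeal →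
      ∀ n : ℕ, ∃ d ∈ signedLocalPoints κ (v.adicCompletion ℚ) W 1 n,
        ∀ x ∈ signedLocalPoints κ (v.adicCompletion ℚ) W 1 n,
        ∃ B ∈ AddSubgroup.closure (Set.range fun σ : Field.absoluteGaloisGroup (v.adicCompletion ℚ) ↦ σ • d),
          ∃ b ∈ signedLocalPoints κ (v.adicCompletion ℚ) W 1 n, x = B + 2 • b :=
  Summit.BirchSwinnertonDyer.BirchSwinnertonDyer.Theorems.SignedEC.stub_plusCyclicLayersTwo_of_honda stub_plusHondaSystemTwo

/-- (INJ⁺@2 = v4's registered `stub_plusLocalInjTwo`, «`r₂⁺` injective») — a THEOREM of CYC⁺@2 ∧ LEV0@2 (seat w3's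
`Theorems.SignedEC.stub_plusLocalInjTwo_of_cyclicModTwo`, with LEV0@2 = v5's registered stub `stub_localNonDivTwo`, now w3's
THEOREM of the same name in this namespace, file `…LocalNonDivTwo`).
[cite: BDKim2013, proof of Cor. 3.15 (p. 199), «g_v is injective»] [cite: Kobayashi2003, Props. 8.12, 8.23–8.24, Thm. 9.3 (odd p)] -/
theorem plusLocalInjTwo :
    ∀ (W : WeierstrassCurve ℚ) [W.IsElliptic] [W.IsGloballyMinimal],
      ¬ W.HasCM → W.analyticRank = 0 → GoodSS W 2 → W.frobeniusTrace 2 = 0 →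
      ∀ (κ : ZpExtension ℚ 2), κ.IsCyclotomic →
      ∀ (v : HeightOneSpectrum (𝓞 ℚ)), (2 : 𝓞 ℚ) ∈ v.asIdeal →
      ∀ y ∈ (signedSelmerInfty W κ 1).comap (W.layerToInfty κ 0),
        W.localResOver 2 (κ.layerSubgroup 0) (v.adicCompletion ℚ) y = 0 :=
  Summit.BirchSwinnertonDyer.BirchSwinnertonDyer.Theorems.SignedEC.stub_plusLocalInjTwo_of_cyclicModTwo
    stub_localNonDivTwo plusCyclicLayersTwo

/-- (LOC⁺@2 = v5's registered `stub_plusLocKummerTwo`) — a THEOREM of HONDA⁺@2: at the place `w ∋ 2`, pick a local lift `g`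
of the topological generator (`IsCyclotomic.exists_isTopGenerator_resGalOfEmb_adicCompletion`), get the pair-form coinvariant
vanishing on `⋃ₙ E⁺(ℚ_{2,n}·ℚ_w)` from the Honda system (w3's `SignedEC.plusCoinvPair_two_of_honda`, stated with `g⁻¹`; `g⁻¹x′ − x′
= −(g y − y)` for `y = g⁻¹x′`), and feed w2's LOC engine `SignedEC.plusLocKummer_two_of_coinvariantsDiv` (Greenberg's Lemma 4.7
surjectivity for the plus Kummer condition). [cite: GreenbergLNM1716, §4 Lemma 4.7 (pp. 107–108)]
[cite: BDKim2013, Props. 2.2–2.3, proof of Cor. 3.15] [cite: Kobayashi2003, Prop. 8.12, Thm. 9.3 (odd p)] -/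
theorem plusLocKummerTwo :
    ∀ (W : WeierstrassCurve ℚ) [W.IsElliptic] [W.IsGloballyMinimal],
      ¬ W.HasCM → W.analyticRank = 0 → GoodSS W 2 → W.frobeniusTrace 2 = 0 →
      ∀ (κ : ZpExtension ℚ 2), κ.IsCyclotomic →
      ∀ t : W.subgroupH1 2 κ.kerSubgroup,
        (∀ σ : Field.absoluteGaloisGroup ℚ, W.conjH1 2 κ.kerSubgroup σ t - t ∈ signedSelmerInfty W κ 1) →
        ∀ w : HeightOneSpectrum (𝓞 ℚ), ((2 : ℕ) : 𝓞 ℚ) ∈ w.asIdeal →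
        ∃ xw : discreteH1 (localSubgroup (⊤ : Subgroup (Field.absoluteGaloisGroup ℚ)) (w.adicCompletion ℚ))
            (localPoints W (w.adicCompletion ℚ)),
          (∃ k : ℕ, 2 ^ k • xw = 0) ∧
          ∀ y : W.subgroupH1 2 (⊤ : Subgroup (Field.absoluteGaloisGroup ℚ)),
            W.localResOver 2 ⊤ (w.adicCompletion ℚ) y = xw →
            t - W.resOfLe 2 (le_top : κ.kerSubgroup ≤ ⊤) y ∈
              localKummerOverOfEmb W 2 κ.kerSubgroup (closureEmb (K := ℚ) (w.adicCompletion ℚ))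
                (⨆ n, signedLocalPoints κ (w.adicCompletion ℚ) W 1 n) := by
  intro W _ _ hcm hr hss ha κ hκ t ht w hw
  have hw' : (2 : 𝓞 ℚ) ∈ w.asIdeal := by exact_mod_cast hw
  obtain ⟨d, hd, htr, hgen, hgen0⟩ := stub_plusHondaSystemTwo W hcm hr hss ha κ hκ w hw'
  refine Summit.BirchSwinnertonDyer.BirchSwinnertonDyer.Theorems.SignedEC.plusLocKummer_two_of_coinvariantsDiv W κ 1 hκ hw
    ?_ t ht
  intro g hg x hx k
  -- w3's pair-form coinvariant vanishing for the top generator `g` (stated with `g⁻¹`)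
  have hg' : κ.IsTopGenerator (resGalOfEmb (closureEmb (K := ℚ) (w.adicCompletion ℚ)) g) := hg
  obtain ⟨x', hx', m, hm, hxm⟩ :=
    Summit.BirchSwinnertonDyer.BirchSwinnertonDyer.Theorems.SignedEC.plusCoinvPair_two_of_honda W hss hκ w hw' hg' d hd htr
      hgen hgen0 x hx k
  -- `y := −(g⁻¹ • x') ∈ ⋃ₙ E⁺_n` and `g • y − y = g⁻¹ • x' − x'`
  have hsmul : g⁻¹ • x' ∈ ⨆ n, signedLocalPoints κ (w.adicCompletion ℚ) W 1 n := by
    obtain ⟨n, hn⟩ := (AddSubgroup.mem_iSup_of_directed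
      (Summit.BirchSwinnertonDyer.Rank1Residual.Additive.signedLocalPointsOfEmb_mono κ
        (closureEmb (K := ℚ) (w.adicCompletion ℚ)) W 1).directed_le).1 hx'
    refine (AddSubgroup.mem_iSup_of_directed
      (Summit.BirchSwinnertonDyer.Rank1Residual.Additive.signedLocalPointsOfEmb_mono κ
        (closureEmb (K := ℚ) (w.adicCompletion ℚ)) W 1).directed_le).2 ⟨n, ?_⟩
    rw [Summit.BirchSwinnertonDyer.Rank1Residual.Additive.signedLocalPointsOfEmb_eq_towerSigned] at hn ⊢
    exact Summit.BirchSwinnertonDyer.Rank1Residual.Additive.smul_mem_towerSignedLocalPointsOfEmb κ.layerSubgroup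
      (closureEmb (K := ℚ) (w.adicCompletion ℚ)) W 1 n g⁻¹ hn
  refine ⟨-(g⁻¹ • x'), AddSubgroup.neg_mem _ hsmul, k, m,
    Summit.BirchSwinnertonDyer.BirchSwinnertonDyer.Theorems.SignedEC.iSup_signedLocalPointsOfEmb_le_localTowerPointsOfEmb W κ 1
      (closureEmb (K := ℚ) (w.adicCompletion ℚ)) hm, ?_⟩
  rw [← hxm, smul_neg, smul_inv_smul, neg_sub_neg]

/-- (EC2) the signed `Γ`-Euler characteristic at `2` on the `a₂ = 0`, rank-0, non-CM sub-row (= v1's `stub_signedEulerCharTwo`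
= 19097 `signed_halves_two.stub_zeroSignedEulerChar`, verbatim) — a THEOREM of HONDA⁺@2 and PUB through `plusLocalInjTwo`, `plusLocKummerTwo` and seat w2's
door `Theorems.SignedEC.signedEulerChar_two_of_localInj_of_print_of_kummerLoc` (Greenberg §4 for `Sel⁺`, `Σ₀` = the bad places).
[cite: BDKim2013, Cor. 3.15] [cite: GreenbergLNM1716, §4 pp. 102–109, Lemma 4.7, Props. 4.12–4.13, pp. 119–122, §5 p. 140] -/
theorem signedEulerCharTwo (hC : Greenberg1999.casselsSurjectivity_H1Sigma ℚ)
    (h412 : Greenberg1999.prop412_noFiniteSubmodule_H1Sigma_of_rank_one) (hcork : Greenberg1999.h1Sigma_zpCorank_le_degree ℚ)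
    (hP108 : Greenberg1999.localQuotient_restriction_surjective ℚ) (hWL : Greenberg1999.h1SigmaInfty_rank_eq_one) :
    ∀ (W : WeierstrassCurve ℚ) [W.IsElliptic] [W.IsGloballyMinimal],
      ¬ W.HasCM → W.analyticRank = 0 → GoodSS W 2 → W.frobeniusTrace 2 = 0 →
      ∀ (κ : ZpExtension ℚ 2) (γ : Field.absoluteGaloisGroup ℚ),
        κ.IsCyclotomic → κ.IsTopGenerator γ → Finite (W.selmerGroupPInfty 2) →
        Finite (endInvariants (conjSignedSelmerInfty W κ 1 γ - 1)) ∧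
          ∃ u : ℤ_[2]ˣ, (Nat.card (endInvariants (conjSignedSelmerInfty W κ 1 γ - 1)) : ℚ_[2]) =
            ((u : ℤ_[2]) : ℚ_[2]) * ((2 : ℕ) : ℚ_[2]) ^ (padicValNat 2 W.tamagawaProduct) *
              (Nat.card (W.selmerGroupPInfty 2) : ℚ_[2]) *
                (Nat.card (EndCoinvariants (conjSignedSelmerInfty W κ 1 γ - 1)) : ℚ_[2]) := by
  intro W _ _ hcm hr hss ha κ γ hκ hγ hSel
  -- `Σ₀` := the (finite) set of bad places of `W`
  have hbad : (W.badPlaces (𝓞 ℚ)).Finite := W.finite_badPlaces_holds (𝓞 ℚ)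
  have hgood : ∀ w : HeightOneSpectrum (𝓞 ℚ), w ∉ hbad.toFinset → ((2 : ℕ) : 𝓞 ℚ) ∉ w.asIdeal →
      W.HasGoodReductionAt w := by
    intro w hw _
    by_contra hng
    exact hw (hbad.mem_toFinset.mpr hng)
  exact Summit.BirchSwinnertonDyer.BirchSwinnertonDyer.Theorems.SignedEC.signedEulerChar_two_of_localInj_of_print_of_kummerLoc
    W κ hss hκ hγ hbad.toFinset hgood (plusLocalInjTwo W hcm hr hss ha κ hκ) hC h412 hcork hP108 hWL
    (fun t _ ht w hw ↦ plusLocKummerTwo W hcm hr hss ha κ hκ t ht w hw) hSel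

/-- **K4 modulo the five printed facts** (composition of line `eulerchar` v6 with the research stub HONDA⁺@2 PROVED): conjunct
(i) is the landed finite-generation theorem `SignedSelmerDualData.moduleFinite`, conjunct (ii) = H4 (p566400) ∘ (EC2).
[cite: BDKim2013, Cor. 3.15] [cite: Kobayashi2003, Thm. 1.2, Prop. 8.12] [cite: GreenbergLNM1716, §4] -/
theorem signedControlAtTwo_of_pub (hC : Greenberg1999.casselsSurjectivity_H1Sigma ℚ)
    (h412 : Greenberg1999.prop412_noFiniteSubmodule_H1Sigma_of_rank_one) (hcork : Greenberg1999.h1Sigma_zpCorank_le_degree ℚ)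
    (hP108 : Greenberg1999.localQuotient_restriction_surjective ℚ) (hWL : Greenberg1999.h1SigmaInfty_rank_eq_one) :
    Summit.BirchSwinnertonDyer.BirchSwinnertonDyer.Theses.ThetaPartnerAtTwo.SignedControlAtTwo := by
  intro W _ _ hcm hr hss ha
  refine ⟨fun κ γ _ hγ D => SignedSelmerDualData.moduleFinite hγ D, ?_⟩
  intro κ γ hκ hγ D _ hX g hg hSel
  exact stub_controlOfEulerCharTwo W κ γ hγ D hX g hg hSel (signedEulerCharTwo hC h412 hcork hP108 hWL W hcm hr hss ha κ γ hκ hγ hSel)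

end Summit.BirchSwinnertonDyer.BirchSwinnertonDyer.Theorems.SignedControlAtTwoOfPubProof

namespace Summit.BirchSwinnertonDyer.BirchSwinnertonDyer.Theorems

/-- **K4P `SignedControlAtTwoOfPub` (stmt-BirchSwinnertonDyer-24144, route `ResidualThetaTransportAtTwo`, crux r7) PROVED**: the five
printed facts of Greenberg LNM 1716 / Kato (Cassels' surjectivity Prop. 4.13, Prop. 4.12, the corank bound pp. 119–120, local-quotient
surjectivity p. 108, weak Leopoldt rank one §5 / Kato 12.4), BY NAME, imply K4 `SignedControlAtTwo` verbatim: on the sub-row `¬CM, r_an = 0,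
GoodSS W 2, a₂ = 0`, `X⁺(E/ℚ_∞)` is finitely generated over `Λ` and `g(0) ∼ 2^{v₂ ∏ c_ℓ}·#Sel_{2^∞}(E/ℚ)` (B. D. Kim's Cor. 3.15 READ AT 2).
The research content — the plus Honda system at `2` (HONDA⁺@2), Kobayashi's local theory read at `2` on the `ℤ₂`-tower — is the tree
theorem `Cruxes.SignedControlAtTwo.EulerChar.stub_plusHondaSystemTwo` (p591589). HONEST FRAMING: conditional on five PRINTED facts by
name (the D-0131 shape); BSD is not proved by this. [cite: BDKim2013, Cor. 3.15 (p. 199)] [cite: Kobayashi2003, Thm. 1.2, §8.4, Thm. 9.3]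
[cite: GreenbergLNM1716, Prop. 4.12, Prop. 4.13, pp. 108, 119–120, 140] [cite: Kato2004Asterisque, Thm. 12.4] -/
theorem SignedControlAtTwoOfPub_proof :
    Summit.BirchSwinnertonDyer.BirchSwinnertonDyer.Theses.ResidualThetaTransportAtTwo.SignedControlAtTwoOfPub := by
  intro hC h412 hcork hP108 hWL
  exact SignedControlAtTwoOfPubProof.signedControlAtTwo_of_pub hC h412 hcork hP108 hWL

end Summit.BirchSwinnertonDyer.BirchSwinnertonDyer.Theorems

end
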